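import Literature.NumberTheory.LFunctions.DeterminantEquationDFIProofs
import HarnessLib

/-!
# Bilinear forms with Kloosterman fractions: Duke–Friedlander–Iwaniec's bound from Bettin–Chandee's

Topic `NumberTheory/LFunctions`.  The named fact
`DukeFriedlanderIwaniec1997_bilinearKloostermanFractions` (`DeterminantEquationDFI.lean`; the
Proposition of Duke–Friedlander–Iwaniec, LMS LNS 237 (1997) p. 110 = Theorem 2 of *Bilinear forms
with Kloosterman fractions*, Invent. Math. 128 (1997), twisted by `e(X/mn)`) asserts
`|∑∑_{(m,n)=1} α_m β_n e(k m̄/n + X/mn)| ≪_ε ‖α‖‖β‖ (1 + |X|/MN)(|k| + MN)^{3/8}(M+N)^{11/48+ε}`.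
S. Bettin, V. Chandee, *Trilinear forms with Kloosterman fractions*, Adv. Math. 328 (2018),
Theorem 1, "improve upon" this bound (their (ewfc)); for a single numerator (`A = 1`, `ϑ = k`)
their Theorem 1 reads
`|∑∑_{(m,n)=1} α_m β_n e(k m̄/n)| ≪_ε ‖α‖‖β‖ (1 + |k|/MN)^{1/2}((MN)^{7/20+ε}(M+N)^{1/4} + (MN)^{3/8+ε}(M+N)^{1/8})`.

This file PROVES the implication (the top layer of a proof of the named fact along
Bettin–Chandee's paper):

* `DFI_shape_of_BC_and_trivial` — real-variable bookkeeping: for `M, N ≥ 1/2`, `R ≥ 1`, a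
  quantity bounded both trivially by `2(MN)^{1/2} F` and by Bettin–Chandee's shape (with `ε/2`)
  is `≤ (2 + 8K) F (R + MN)^{3/8}(M+N)^{11/48+ε}` (cases `R ≤ MN`; `(MN)^{1/2} ≤ R^{3/8}(M+N)^{11/48}`;
  and the remaining range, where `R^{1/8} < (MN)^{1/6}(M+N)^{-11/144}`; in logarithmic coordinates
  every comparison is linear, using `(M+N)/4 ≤ MN ≤ (M+N)²`);
* `DFI_bilinear_trivial_bound` — `|𝓑| ≤ 2 (MN)^{1/2} ‖α‖‖β‖`;
* **`DukeFriedlanderIwaniec1997_bilinearKloostermanFractions_of_BettinChandee`** — Bettin–Chandee's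
  Theorem 1 (case `A = 1`, hypothesis written out in full; it is not yet in the tree) implies the
  named fact, via the tree's `…_of_untwisted` (removal of the twist `e(X/mn)`).

## References

* S. Bettin, V. Chandee, Adv. Math. 328 (2018) 1234–1262 (arXiv:1502.00769), Theorem 1 and §1
  (ewfc). [BettinChandee2018]
* W. Duke, J. Friedlander, H. Iwaniec, Invent. Math. 128 (1997) 23–43, Theorem 2; LMS Lecture Note
  Ser. 237 (1997), Proposition p. 110. [DukeFriedlanderIwaniec1997]
  [DukeFriedlanderIwaniec1997Determinant]
-/

noncomputable section

open Finset Real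

namespace Literature.NumberTheory.LFunctions

/-- **Range bookkeeping: Bettin–Chandee's bound and the trivial bound imply the
Duke–Friedlander–Iwaniec shape.**  Let `M, N ≥ 1/2`, `R ≥ 1`, `F ≥ 0`, `ε > 0`, `K > 0`, and let
`B` satisfy the trivial bound `B ≤ 2 (MN)^{1/2} F` and the Bettin–Chandee bound
`B ≤ K F (1 + R/MN)^{1/2} ((MN)^{7/20+ε/2}(M+N)^{1/4} + (MN)^{3/8+ε/2}(M+N)^{1/8})`.  Then
`B ≤ (2 + 8K) F (R + MN)^{3/8} (M+N)^{11/48+ε}`.  (Cases: `R ≤ MN`; `R > MN` and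
`(MN)^{1/2} ≤ R^{3/8}(M+N)^{11/48}` (trivial bound); otherwise `R^{1/8} < (MN)^{1/6}(M+N)^{-11/144}`
and the Bettin–Chandee bound; throughout `(M+N)/4 ≤ MN ≤ (M+N)²`.) [folklore] -/
theorem DFI_shape_of_BC_and_trivial {ε K M N R F B : ℝ} (hε : 0 < ε) (hK : 0 < K)
    (hM : 1 / 2 ≤ M) (hN : 1 / 2 ≤ N) (hR : 1 ≤ R) (hF : 0 ≤ F)
    (htriv : B ≤ 2 * Real.sqrt (M * N) * F)
    (hBC : B ≤ K * F * (1 + R / (M * N)) ^ (1 / 2 : ℝ) *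
      ((M * N) ^ (7 / 20 + ε / 2) * (M + N) ^ (1 / 4 : ℝ) +
        (M * N) ^ (3 / 8 + ε / 2) * (M + N) ^ (1 / 8 : ℝ))) :
    B ≤ (2 + 8 * K) * F * (R + M * N) ^ (3 / 8 : ℝ) * (M + N) ^ (11 / 48 + ε) := by
  have hM0 : 0 < M := by linarith
  have hN0 : 0 < N := by linarith
  have hQ0 : 0 < M * N := mul_pos hM0 hN0
  have hP1 : 1 ≤ M + N := by linarith
  have hP0 : 0 < M + N := by linarith
  have hR0 : 0 < R := by linarith
  -- logarithmic coordinates `q = log MN`, `p = log (M+N)`, `r = log R`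
  obtain ⟨q, hq⟩ : ∃ q : ℝ, q = Real.log (M * N) := ⟨_, rfl⟩
  obtain ⟨p, hp⟩ : ∃ p : ℝ, p = Real.log (M + N) := ⟨_, rfl⟩
  obtain ⟨r, hr⟩ : ∃ r : ℝ, r = Real.log R := ⟨_, rfl⟩
  have hp0 : 0 ≤ p := hp ▸ Real.log_nonneg hP1
  have hr0 : 0 ≤ r := hr ▸ Real.log_nonneg hR
  -- `MN ≤ (M+N)²` and `(M+N)/4 ≤ MN`, in logarithms
  have hqp : q ≤ 2 * p := by
    have h1 : M * N ≤ (M + N) ^ 2 := by nlinarith [sq_nonneg (M - N)]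
    have h2 : Real.log (M * N) ≤ Real.log ((M + N) ^ 2) := Real.log_le_log hQ0 h1
    rw [Real.log_pow, ← hq, ← hp] at h2
    push_cast at h2
    linarith
  have hlog4 : Real.log 4 ≤ 2 := by
    have h2 : Real.log 4 = 2 * Real.log 2 := by
      rw [show (4 : ℝ) = 2 ^ 2 by norm_num, Real.log_pow]; push_cast; ring
    rw [h2]
    have := Real.log_two_lt_d9
    linarith
  have hpq : p - 2 ≤ q := by
    have h1 : (M + N) / 4 ≤ M * N := by
      rcases le_total M N with h | h
      · nlinarith
      · nlinarith
    have h2 : Real.log ((M + N) / 4) ≤ Real.log (M * N) := Real.log_le_log (by positivity) h1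
    rw [Real.log_div hP0.ne' (by norm_num), ← hp, ← hq] at h2
    linarith
  have hεq : ε / 2 * q ≤ ε * p := by
    have := mul_le_mul_of_nonneg_left hqp (by positivity : (0 : ℝ) ≤ ε / 2)
    linarith
  have hεp : 0 ≤ ε * p := mul_nonneg hε.le hp0
  -- powers as exponentials
  have eQ : ∀ a : ℝ, (M * N) ^ a = Real.exp (a * q) := fun a => by
    rw [Real.rpow_def_of_pos hQ0, mul_comm, hq]
  have eP : ∀ a : ℝ, (M + N) ^ a = Real.exp (a * p) := fun a => by
    rw [Real.rpow_def_of_pos hP0, mul_comm, hp]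
  have eR : ∀ a : ℝ, R ^ a = Real.exp (a * r) := fun a => by
    rw [Real.rpow_def_of_pos hR0, mul_comm, hr]
  have esqrt : Real.sqrt (M * N) = Real.exp (1 / 2 * q) := by
    rw [Real.sqrt_eq_rpow, eQ]
  -- the target dominates `exp(3r/8 + (11/48+ε)p)` and `exp(3q/8 + (11/48+ε)p)`
  set G : ℝ := (R + M * N) ^ (3 / 8 : ℝ) * (M + N) ^ (11 / 48 + ε) with hG
  have hG_r : Real.exp (3 / 8 * r + (11 / 48 + ε) * p) ≤ G := by
    rw [Real.exp_add, hG, ← eR, ← eP]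
    gcongr
    linarith
  have hG_q : Real.exp (3 / 8 * q + (11 / 48 + ε) * p) ≤ G := by
    rw [Real.exp_add, hG, ← eQ, ← eP]
    gcongr
    linarith
  have hKF : 0 ≤ K * F := mul_nonneg hK.le hF
  -- constants: `2^{1/2} ≤ 3/2`, `e^{1/20} ≤ 3`
  have hsqrt2 : (2 : ℝ) ^ (1 / 2 : ℝ) ≤ 3 / 2 := by
    rw [← Real.sqrt_eq_rpow, Real.sqrt_le_left (by norm_num)]
    norm_num
  have hexp : Real.exp (1 / 20) ≤ 3 := by
    have h1 : Real.exp (1 / 20) ≤ Real.exp 1 := Real.exp_le_exp.mpr (by norm_num)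
    have h2 := Real.exp_one_lt_d9
    linarith
  -- the Bettin–Chandee terms as exponentials
  have eT : (M * N) ^ (7 / 20 + ε / 2) * (M + N) ^ (1 / 4 : ℝ) +
      (M * N) ^ (3 / 8 + ε / 2) * (M + N) ^ (1 / 8 : ℝ) =
      Real.exp ((7 / 20 + ε / 2) * q + 1 / 4 * p) + Real.exp ((3 / 8 + ε / 2) * q + 1 / 8 * p) := by
    rw [eQ, eP, eQ, eP, ← Real.exp_add, ← Real.exp_add]
  rw [eT] at hBC
  by_cases h1 : R ≤ M * N
  · -- Case `R ≤ MN`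
    have hfac : (1 + R / (M * N)) ^ (1 / 2 : ℝ) ≤ 3 / 2 := by
      have h2 : 1 + R / (M * N) ≤ 2 := by
        have h3 : R / (M * N) ≤ 1 := (div_le_one hQ0).mpr h1
        linarith only [h3]
      exact (Real.rpow_le_rpow (by positivity) h2 (by norm_num)).trans hsqrt2
    have hT₁ : Real.exp ((7 / 20 + ε / 2) * q + 1 / 4 * p) ≤
        Real.exp (1 / 20) * Real.exp (3 / 8 * q + (11 / 48 + ε) * p) := by
      rw [← Real.exp_add]
      exact Real.exp_le_exp.mpr (by linarith only [hpq, hεq, hp0, hεp])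
    have hT₂ : Real.exp ((3 / 8 + ε / 2) * q + 1 / 8 * p) ≤
        Real.exp (3 / 8 * q + (11 / 48 + ε) * p) :=
      Real.exp_le_exp.mpr (by linarith only [hεq, hp0, hεp])
    set X : ℝ := Real.exp (3 / 8 * q + (11 / 48 + ε) * p) with hX
    have hX0 : 0 ≤ X := (Real.exp_pos _).le
    calc B ≤ K * F * (1 + R / (M * N)) ^ (1 / 2 : ℝ) *
          (Real.exp ((7 / 20 + ε / 2) * q + 1 / 4 * p) +
            Real.exp ((3 / 8 + ε / 2) * q + 1 / 8 * p)) := hBC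
      _ ≤ K * F * (3 / 2) * (Real.exp (1 / 20) * X + X) := by gcongr
      _ ≤ K * F * (3 / 2) * (3 * X + X) := by gcongr
      _ = 6 * (K * F) * X := by ring
      _ ≤ (2 + 8 * K) * F * X := by
          linarith only [mul_nonneg hKF hX0, mul_nonneg hF hX0]
      _ ≤ (2 + 8 * K) * F * G := by gcongr
      _ = _ := by rw [hG]; ring
  · have h1' : M * N < R := not_le.mp h1
    have hqr : q ≤ r := by
      rw [hq, hr]; exact Real.log_le_log hQ0 h1'.le
    by_cases h2 : 1 / 2 * q ≤ 3 / 8 * r + 11 / 48 * p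
    · -- Case: the trivial bound suffices
      calc B ≤ 2 * Real.sqrt (M * N) * F := htriv
        _ = 2 * F * Real.exp (1 / 2 * q) := by rw [esqrt]; ring
        _ ≤ 2 * F * Real.exp (3 / 8 * r + (11 / 48 + ε) * p) := by
            gcongr 2 * F * ?_
            exact Real.exp_le_exp.mpr (by linarith only [h2, hεp])
        _ ≤ 2 * F * G := by gcongr
        _ ≤ (2 + 8 * K) * F * G := by
            have h3 : 0 ≤ F * G := mul_nonneg hF (by positivity)
            have h4 : 0 ≤ K * (F * G) := mul_nonneg hK.le h3
            linarith only [h3, h4]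
        _ = _ := by rw [hG]; ring
    · -- Case: `MN < R`, `R^{3/8}(M+N)^{11/48} < (MN)^{1/2}`: Bettin–Chandee
      have h2' : 3 / 8 * r + 11 / 48 * p < 1 / 2 * q := not_le.mp h2
      have hfac : (1 + R / (M * N)) ^ (1 / 2 : ℝ) ≤ 3 / 2 * Real.exp (1 / 2 * (r - q)) := by
        have hRQ : R / (M * N) = Real.exp (r - q) := by
          rw [Real.exp_sub, hr, hq, Real.exp_log hR0, Real.exp_log hQ0]
        have h3 : 1 + R / (M * N) ≤ 2 * Real.exp (r - q) := by
          have h4 : 1 ≤ Real.exp (r - q) := Real.one_le_exp (by linarith only [hqr])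
          rw [hRQ]; linarith only [h4]
        calc (1 + R / (M * N)) ^ (1 / 2 : ℝ) ≤ (2 * Real.exp (r - q)) ^ (1 / 2 : ℝ) :=
              Real.rpow_le_rpow (by positivity) h3 (by norm_num)
          _ = (2 : ℝ) ^ (1 / 2 : ℝ) * Real.exp (1 / 2 * (r - q)) := by
              rw [Real.mul_rpow (by norm_num) (Real.exp_pos _).le, ← Real.exp_mul, mul_comm (r - q)]
          _ ≤ 3 / 2 * Real.exp (1 / 2 * (r - q)) := by gcongr
      set X : ℝ := Real.exp (3 / 8 * r + (11 / 48 + ε) * p) with hX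
      have hX0 : 0 ≤ X := (Real.exp_pos _).le
      have hT₁ : Real.exp (1 / 2 * (r - q)) * Real.exp ((7 / 20 + ε / 2) * q + 1 / 4 * p) ≤ X := by
        rw [← Real.exp_add]
        exact Real.exp_le_exp.mpr (by linarith only [h2', hεq, hqp, hp0, hεp])
      have hT₂ : Real.exp (1 / 2 * (r - q)) * Real.exp ((3 / 8 + ε / 2) * q + 1 / 8 * p) ≤ X := by
        rw [← Real.exp_add]
        exact Real.exp_le_exp.mpr (by linarith only [h2', hεq, hqp, hp0, hεp])
      calc B ≤ K * F * (1 + R / (M * N)) ^ (1 / 2 : ℝ) *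
            (Real.exp ((7 / 20 + ε / 2) * q + 1 / 4 * p) +
              Real.exp ((3 / 8 + ε / 2) * q + 1 / 8 * p)) := hBC
        _ ≤ K * F * (3 / 2 * Real.exp (1 / 2 * (r - q))) *
            (Real.exp ((7 / 20 + ε / 2) * q + 1 / 4 * p) +
              Real.exp ((3 / 8 + ε / 2) * q + 1 / 8 * p)) := by gcongr
        _ = K * F * (3 / 2) *
            (Real.exp (1 / 2 * (r - q)) * Real.exp ((7 / 20 + ε / 2) * q + 1 / 4 * p) +
              Real.exp (1 / 2 * (r - q)) * Real.exp ((3 / 8 + ε / 2) * q + 1 / 8 * p)) := by ring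
        _ ≤ K * F * (3 / 2) * (X + X) := by gcongr
        _ = 3 * (K * F) * X := by ring
        _ ≤ (2 + 8 * K) * F * X := by
            linarith only [mul_nonneg hKF hX0, mul_nonneg hF hX0]
        _ ≤ (2 + 8 * K) * F * G := by gcongr
        _ = _ := by rw [hG]; ring

/-- **The trivial bound** `|𝓑(M,N)| ≤ 2 (MN)^{1/2} ‖α‖ ‖β‖` (Cauchy–Schwarz; the boxes
`1 ≤ m ≤ 2M`, `1 ≤ n ≤ 2N` have at most `2M`, `2N` elements). [folklore] -/
theorem DFI_bilinear_trivial_bound {M N : ℝ} (hM : 0 ≤ M) (hN : 0 ≤ N) (k : ℤ) (α β : ℕ → ℂ) :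
    ‖∑ m ∈ Icc 1 ⌊2 * M⌋₊, ∑ n ∈ Icc 1 ⌊2 * N⌋₊,
        if m.Coprime n then
          α m * β n * Complex.exp (2 * Real.pi * Complex.I *
            ((k : ℂ) * ((((m : ZMod n)⁻¹).val : ℕ) : ℂ) / (n : ℂ)))
        else 0‖ ≤
      2 * Real.sqrt (M * N) * Real.sqrt (∑ m ∈ Icc 1 ⌊2 * M⌋₊, ‖α m‖ ^ 2) *
        Real.sqrt (∑ n ∈ Icc 1 ⌊2 * N⌋₊, ‖β n‖ ^ 2) := by
  set SM := Icc 1 ⌊2 * M⌋₊ with hSM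
  set SN := Icc 1 ⌊2 * N⌋₊ with hSN
  have hcardM : (SM.card : ℝ) ≤ 2 * M := by
    rw [hSM, Nat.card_Icc]; simpa using Nat.floor_le (by positivity : (0 : ℝ) ≤ 2 * M)
  have hcardN : (SN.card : ℝ) ≤ 2 * N := by
    rw [hSN, Nat.card_Icc]; simpa using Nat.floor_le (by positivity : (0 : ℝ) ≤ 2 * N)
  -- termwise `‖·‖ ≤ ‖α m‖ ‖β n‖`
  have hterm : ∀ m n : ℕ, ‖(if m.Coprime n then
      α m * β n * Complex.exp (2 * Real.pi * Complex.I *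
        ((k : ℂ) * ((((m : ZMod n)⁻¹).val : ℕ) : ℂ) / (n : ℂ))) else 0)‖ ≤ ‖α m‖ * ‖β n‖ := by
    intro m n
    split_ifs
    · rw [norm_mul, norm_mul]
      have h : (2 * Real.pi * Complex.I * ((k : ℂ) * ((((m : ZMod n)⁻¹).val : ℕ) : ℂ) / (n : ℂ))) =
          ((2 * Real.pi * ((k : ℝ) * ((((m : ZMod n)⁻¹).val : ℕ) : ℝ) / (n : ℝ)) : ℝ) : ℂ) *
            Complex.I := by
        push_cast; ring
      rw [h, Complex.norm_exp_ofReal_mul_I, mul_one]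
    · rw [norm_zero]; positivity
  have hCSM : ∑ m ∈ SM, ‖α m‖ ≤ Real.sqrt (2 * M) * Real.sqrt (∑ m ∈ SM, ‖α m‖ ^ 2) := by
    have h1 : (∑ m ∈ SM, ‖α m‖) ^ 2 ≤ (2 * M) * ∑ m ∈ SM, ‖α m‖ ^ 2 :=
      sq_sum_le_card_mul_sum_sq.trans (mul_le_mul_of_nonneg_right hcardM
        (Finset.sum_nonneg fun _ _ => sq_nonneg _))
    calc ∑ m ∈ SM, ‖α m‖ = Real.sqrt ((∑ m ∈ SM, ‖α m‖) ^ 2) :=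
          (Real.sqrt_sq (Finset.sum_nonneg fun _ _ => norm_nonneg _)).symm
      _ ≤ Real.sqrt ((2 * M) * ∑ m ∈ SM, ‖α m‖ ^ 2) := Real.sqrt_le_sqrt h1
      _ = _ := Real.sqrt_mul (by positivity) _
  have hCSN : ∑ n ∈ SN, ‖β n‖ ≤ Real.sqrt (2 * N) * Real.sqrt (∑ n ∈ SN, ‖β n‖ ^ 2) := by
    have h1 : (∑ n ∈ SN, ‖β n‖) ^ 2 ≤ (2 * N) * ∑ n ∈ SN, ‖β n‖ ^ 2 :=
      sq_sum_le_card_mul_sum_sq.trans (mul_le_mul_of_nonneg_right hcardN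
        (Finset.sum_nonneg fun _ _ => sq_nonneg _))
    calc ∑ n ∈ SN, ‖β n‖ = Real.sqrt ((∑ n ∈ SN, ‖β n‖) ^ 2) :=
          (Real.sqrt_sq (Finset.sum_nonneg fun _ _ => norm_nonneg _)).symm
      _ ≤ Real.sqrt ((2 * N) * ∑ n ∈ SN, ‖β n‖ ^ 2) := Real.sqrt_le_sqrt h1
      _ = _ := Real.sqrt_mul (by positivity) _
  have hsqrt : Real.sqrt (2 * M) * Real.sqrt (2 * N) = 2 * Real.sqrt (M * N) := by
    rw [← Real.sqrt_mul (by positivity), show 2 * M * (2 * N) = 2 ^ 2 * (M * N) by ring,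
      Real.sqrt_mul (by positivity), Real.sqrt_sq (by norm_num)]
  calc _ ≤ ∑ m ∈ SM, ‖∑ n ∈ SN, (if m.Coprime n then
          α m * β n * Complex.exp (2 * Real.pi * Complex.I *
            ((k : ℂ) * ((((m : ZMod n)⁻¹).val : ℕ) : ℂ) / (n : ℂ))) else 0)‖ := norm_sum_le _ _
    _ ≤ ∑ m ∈ SM, ∑ n ∈ SN, ‖α m‖ * ‖β n‖ :=
        Finset.sum_le_sum fun m _ => (norm_sum_le _ _).trans (Finset.sum_le_sum fun n _ => hterm m n)
    _ = (∑ m ∈ SM, ‖α m‖) * (∑ n ∈ SN, ‖β n‖) := by rw [Finset.sum_mul_sum]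
    _ ≤ (Real.sqrt (2 * M) * Real.sqrt (∑ m ∈ SM, ‖α m‖ ^ 2)) *
          (Real.sqrt (2 * N) * Real.sqrt (∑ n ∈ SN, ‖β n‖ ^ 2)) := by
        have := Finset.sum_nonneg (fun n (_ : n ∈ SN) => norm_nonneg (β n))
        gcongr
    _ = _ := by rw [← hsqrt]; ring

/-- **The Duke–Friedlander–Iwaniec Proposition from Bettin–Chandee's Theorem 1.**  Suppose the
bound of Bettin–Chandee, *Trilinear forms with Kloosterman fractions*, Adv. Math. 328 (2018),
Theorem 1, in the case of a single numerator (`A = 1`, `a = 1`, `ν = 1`, `ϑ = k`; written in the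
tree's conventions: coefficients on `(M, 2M] × (N, 2N]`, `M, N ≥ 1/2`, `k ≠ 0`):
`|∑∑_{(m,n)=1} α_m β_n e(k m̄/n)| ≤ K_ε ‖α‖‖β‖ (1 + |k|/MN)^{1/2} ((MN)^{7/20+ε}(M+N)^{1/4} + (MN)^{3/8+ε}(M+N)^{1/8})`
for every `ε > 0`.  Then the named fact `DukeFriedlanderIwaniec1997_bilinearKloostermanFractions`
(Duke–Friedlander–Iwaniec's bound `(|k| + MN)^{3/8}(M+N)^{11/48+ε}`, twisted by `e(X/mn)`) holds:
Bettin–Chandee's exponents dominate DFI's in every range where DFI's bound is non-trivial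
(`DFI_shape_of_BC_and_trivial`), and the twist is removed by
`DukeFriedlanderIwaniec1997_bilinearKloostermanFractions_of_untwisted`.  (Bettin–Chandee, §1:
their Theorem 1 "improve[s] upon" (ewfc) = DFI's Theorem 2.)
[cite: BettinChandee2018, Theorem 1] [cite: DukeFriedlanderIwaniec1997, Theorem 2] -/
theorem DukeFriedlanderIwaniec1997_bilinearKloostermanFractions_of_BettinChandee
    (hBC : ∀ ε : ℝ, 0 < ε → ∃ K : ℝ, 0 < K ∧
      ∀ (M N : ℝ), 1 / 2 ≤ M → 1 / 2 ≤ N → ∀ (k : ℤ), k ≠ 0 → ∀ (α β : ℕ → ℂ),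
        (∀ m : ℕ, α m ≠ 0 → M < m ∧ (m : ℝ) ≤ 2 * M) →
        (∀ n : ℕ, β n ≠ 0 → N < n ∧ (n : ℝ) ≤ 2 * N) →
        ‖∑ m ∈ Icc 1 ⌊2 * M⌋₊, ∑ n ∈ Icc 1 ⌊2 * N⌋₊,
            if m.Coprime n then
              α m * β n * Complex.exp (2 * Real.pi * Complex.I *
                ((k : ℂ) * ((((m : ZMod n)⁻¹).val : ℕ) : ℂ) / (n : ℂ)))
            else 0‖ ≤
          K * Real.sqrt (∑ m ∈ Icc 1 ⌊2 * M⌋₊, ‖α m‖ ^ 2) *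
            Real.sqrt (∑ n ∈ Icc 1 ⌊2 * N⌋₊, ‖β n‖ ^ 2) *
            (1 + |(k : ℝ)| / (M * N)) ^ (1 / 2 : ℝ) *
            ((M * N) ^ (7 / 20 + ε) * (M + N) ^ (1 / 4 : ℝ) +
              (M * N) ^ (3 / 8 + ε) * (M + N) ^ (1 / 8 : ℝ))) :
    DukeFriedlanderIwaniec1997_bilinearKloostermanFractions := by
  apply DukeFriedlanderIwaniec1997_bilinearKloostermanFractions_of_untwisted
  intro ε hε
  obtain ⟨K, hK, hB⟩ := hBC (ε / 2) (by positivity)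
  refine ⟨2 + 8 * K, by positivity, ?_⟩
  intro M N hM hN k hk α β hα hβ
  have hM0 : 0 ≤ M := by linarith
  have hN0 : 0 ≤ N := by linarith
  have hR : (1 : ℝ) ≤ |(k : ℝ)| := by
    rw [← Int.cast_abs]; exact_mod_cast Int.one_le_abs hk
  have htriv := DFI_bilinear_trivial_bound hM0 hN0 k α β
  have hbc := hB M N hM hN k hk α β hα hβ
  set nα := Real.sqrt (∑ m ∈ Icc 1 ⌊2 * M⌋₊, ‖α m‖ ^ 2) with hnα
  set nβ := Real.sqrt (∑ n ∈ Icc 1 ⌊2 * N⌋₊, ‖β n‖ ^ 2) with hnβ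
  set B := ‖∑ m ∈ Icc 1 ⌊2 * M⌋₊, ∑ n ∈ Icc 1 ⌊2 * N⌋₊,
    if m.Coprime n then
      α m * β n * Complex.exp (2 * Real.pi * Complex.I *
        ((k : ℂ) * ((((m : ZMod n)⁻¹).val : ℕ) : ℂ) / (n : ℂ)))
    else 0‖ with hBdef
  have hnα0 : 0 ≤ nα := Real.sqrt_nonneg _
  have hnβ0 : 0 ≤ nβ := Real.sqrt_nonneg _
  have htriv' : B ≤ 2 * Real.sqrt (M * N) * (nα * nβ) := by
    calc B ≤ _ := htriv
      _ = _ := by ring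
  have hbc' : B ≤ K * (nα * nβ) * (1 + |(k : ℝ)| / (M * N)) ^ (1 / 2 : ℝ) *
      ((M * N) ^ (7 / 20 + ε / 2) * (M + N) ^ (1 / 4 : ℝ) +
        (M * N) ^ (3 / 8 + ε / 2) * (M + N) ^ (1 / 8 : ℝ)) := by
    calc B ≤ _ := hbc
      _ = _ := by ring
  have h := DFI_shape_of_BC_and_trivial hε hK hM hN hR (mul_nonneg hnα0 hnβ0) htriv' hbc'
  calc B ≤ _ := h
    _ = _ := by ring

end Literature.NumberTheory.LFunctions

end
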